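import Summits.Ventures.Crystal3D.Theorems.StickyWulffConstantCoaxialWallLawEndRowRatFrames
import HarnessLib

/-!
# An integer model of the typed census row, IV: Boolean tests and end moves in rational frames; depth-one admissibility

HONEST FRAMING. Venture `Summits/Ventures/Crystal3D` (cell `crystal3d-full`), helper `--supports` the crux `CoaxialWallLaw`
(stmt-Ventures-19481, line `WallLedgerF`).  Continues `…EndRowRatFrames` (seat 19481-p1 gen 12):

* §10 table-parametrised Boolean tests `fullQ / twinFailQ / twinOKQ` (computable, for `native_decide`) and their soundness in any
  `RatFrame`: `isFull_iff`, `not_twinReading`, `twinReading_of`, `not_isMoving`; straight end moves from FULL / GLIDING predecessors;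
  the **CROSS end move** `isEndMove_cross` (predecessor twin-reading across `nv (w c)`, direction `σ Φ(sᵢ)` with `σ (sᵢ·c) = 2`, end
  ball `q − σ·mirQ`, not moving in the REFLECTED frame `F.reflect c` — definitionally `Φ.trans (reflection across the normal)`);
* §11 the model LETTER `L⁻¹(menuOf (cubeInt c₀))` of a sign vector, `refl_letter_trans_L` (the depth-one chain frame `M_μ.trans L`
  IS `(base.reflect c₀).Φ`), `adm_depth1` (admissibility of the class `[μ]` for a root with `sᵢ·c₀ = 2`, direction `−Φ(sᵢ)`), the
  `S1 / S2` disjunctions from a non-zero rise number, `isEndPair_gen`, and the `σ = 1` cross move in the base frame.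
WHAT THIS IS NOT: no census constant is claimed here; F-C1 not moved.
-/

noncomputable section

namespace Summit.Ventures.Crystal3D.Theorems

open Summit.Ventures.Crystal3D Finset NearIdentity
open Literature.MathematicalPhysics.StatisticalMechanics (barlowPos fccStacking constHagg)
open scoped InnerProductSpace

namespace EndRowFloor

/-! ### §10 Tests and moves in a rational frame -/

/-- Adding a slot image of the frame to a rational point. -/
theorem PQ_add_slot (F : RatFrame) (v : Fin 3 → ℚ) (i : Fin 12) : PQ v + F.Φ (slotSite i) = PQ (v + F.g i) := by
  rw [F.hslot, ← PQ_add]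

/-- The mirror of a slot image across a menu normal is the rational point `mirQ`. -/
theorem RatFrame.mirror_eq (F : RatFrame) (i : Fin 12) (c : Fin 8) :
    F.Φ (slotSite i) - (2 * ⟪F.Φ (slotSite i), nv (F.w c)⟫_ℝ) • nv (F.w c) = Qr (iptQ (mirQ F.g F.w i c)) := by
  have h6 : Real.sqrt 6 ≠ 0 := by positivity
  rw [F.hinner, F.hslot, mirQ, iptQ_sub, map_sub, iptQ_smul, map_smul, nv, smul_smul]
  congr 2
  push_cast
  field_simp

/-- `IsFull` in the frame is the rational fullness test. -/
theorem RatFrame.isFull_iff (F : RatFrame) (S : Finset (Fin 3 → ℤ)) (v : Fin 3 → ℚ) :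
    IsFull (Xof S) F.Φ (PQ v) ↔ fullQ F.g (SQ S) v = true := by
  unfold IsFull fullQ
  rw [decide_eq_true_iff, fccSlots_eq_image]
  simp only [Finset.mem_image, Finset.mem_univ, true_and, forall_exists_index, forall_apply_eq_imp_iff]
  refine forall_congr' fun i => ?_
  rw [PQ_add_slot, mem_Xof_Q]

/-- No twin reading in the frame once every menu normal has a failing clause. -/
theorem RatFrame.not_twinReading (F : RatFrame) {S : Finset (Fin 3 → ℤ)} {v : Fin 3 → ℚ}
    (h : ∀ c : Fin 8, twinFailQ F.g F.w (SQ S) v c = true) (m : EuclideanSpace ℝ (Fin 3)) :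
    ¬ IsTwinReading (Xof S) F.Φ m (PQ v) := by
  intro htw
  obtain ⟨hmenu, hlow, hmir, hfar⟩ := htw
  obtain ⟨c, rfl⟩ := F.hmenu m hmenu
  have hc := h c
  rw [twinFailQ, decide_eq_true_iff] at hc
  obtain ⟨i, hi⟩ := hc
  have hin := F.hinner i c
  have h6 := sqrt6_pos
  rcases hi with ⟨hd, hnot⟩ | ⟨hd, hnot⟩ | ⟨hd, hmem⟩
  · apply hnot
    have := hlow (slotSite i) (slotSite_mem i) (by
      rw [hin]; exact div_nonpos_of_nonpos_of_nonneg (by exact_mod_cast hd) h6.le)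
    rwa [PQ_add_slot, mem_Xof_Q] at this
  · apply hnot
    have := hmir (slotSite i) (slotSite_mem i) (by
      rw [hin]; exact div_neg_of_neg_of_pos (by exact_mod_cast hd) h6)
    rwa [F.mirror_eq, ← PQ_add, mem_Xof_Q] at this
  · apply hfar (slotSite i) (slotSite_mem i) (by rw [hin]; positivity)
    rw [PQ_add_slot, mem_Xof_Q]; exact hmem

/-- A twin reading in the frame from the rational success test. -/
theorem RatFrame.twinReading_of (F : RatFrame) {S : Finset (Fin 3 → ℤ)} {v : Fin 3 → ℚ} (c : Fin 8)
    (h : twinOKQ F.g F.w (SQ S) v c = true) : IsTwinReading (Xof S) F.Φ (nv (F.w c)) (PQ v) := by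
  rw [twinOKQ, decide_eq_true_iff] at h
  obtain ⟨hlow, hmir, hfar⟩ := h
  have h6 := sqrt6_pos
  refine ⟨F.hmenu' c, ?_, ?_, ?_⟩
  · intro w hw hle
    obtain ⟨i, rfl⟩ := exists_slotSite_eq hw
    rw [F.hinner] at hle
    have hd : dz (slotInt i) (cubeInt c) ≤ 0 := by
      by_contra hpos
      push Not at hpos
      have : (0 : ℝ) < (dz (slotInt i) (cubeInt c) : ℝ) / Real.sqrt 6 := by positivity
      linarith
    rw [PQ_add_slot, mem_Xof_Q]; exact hlow i hd
  · intro w hw hlt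
    obtain ⟨i, rfl⟩ := exists_slotSite_eq hw
    have hlt' := hlt
    rw [F.hinner] at hlt'
    have hd : dz (slotInt i) (cubeInt c) < 0 := by
      by_contra hnn
      push Not at hnn
      have : (0 : ℝ) ≤ (dz (slotInt i) (cubeInt c) : ℝ) / Real.sqrt 6 := by positivity
      linarith
    rw [F.mirror_eq, ← PQ_add, mem_Xof_Q]; exact hmir i hd
  · intro w hw hpos
    obtain ⟨i, rfl⟩ := exists_slotSite_eq hw
    rw [F.hinner] at hpos
    have hd : 0 < dz (slotInt i) (cubeInt c) := by
      by_contra hnp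
      push Not at hnp
      have : (dz (slotInt i) (cubeInt c) : ℝ) / Real.sqrt 6 ≤ 0 :=
        div_nonpos_of_nonpos_of_nonneg (by exact_mod_cast hnp) h6.le
      linarith
    rw [PQ_add_slot, mem_Xof_Q]; exact hfar i hd

/-- Not moving (v1) in the frame. -/
theorem RatFrame.not_isMoving (F : RatFrame) {S : Finset (Fin 3 → ℤ)} {v : Fin 3 → ℚ} (d : EuclideanSpace ℝ (Fin 3))
    (hfull : fullQ F.g (SQ S) v = false) (htw : ∀ c : Fin 8, twinFailQ F.g F.w (SQ S) v c = true) :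
    ¬ IsMoving (Xof S) WordVersion.v1 F.Φ d (PQ v) := by
  rintro (h | ⟨m, hm, -⟩ | ⟨h, -⟩)
  · have := (F.isFull_iff S v).1 h
    rw [hfull] at this
    exact Bool.false_ne_true this
  · exact F.not_twinReading htw m hm
  · exact absurd h (by decide)

/-- Straight end move `q → b = q + gᵢ` from a FULL predecessor, in the frame. -/
theorem RatFrame.isEndMove_full (F : RatFrame) {S : Finset (Fin 3 → ℤ)} (q b : Fin 3 → ℚ) (i : Fin 12)
    (hbq : b = q + F.g i) (hq : fullQ F.g (SQ S) q = true) (hb : fullQ F.g (SQ S) b = false)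
    (htw : ∀ c : Fin 8, twinFailQ F.g F.w (SQ S) b (c) = true) :
    IsEndMove (Xof S) WordVersion.v1 F.Φ (F.Φ (slotSite i)) (PQ q) (PQ b) := by
  subst hbq
  exact Or.inl ⟨Or.inl ((F.isFull_iff S q).2 hq), (PQ_add_slot F q i).symm, F.not_isMoving _ hb htw⟩

/-- Straight end move from a GLIDING predecessor (twin reading across `nv (w c)`, direction in its plane). -/
theorem RatFrame.isEndMove_glide (F : RatFrame) {S : Finset (Fin 3 → ℤ)} (q b : Fin 3 → ℚ) (i : Fin 12) (c : Fin 8)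
    (hbq : b = q + F.g i) (hq : twinOKQ F.g F.w (SQ S) q c = true) (hperp : dz (slotInt i) (cubeInt c) = 0)
    (hb : fullQ F.g (SQ S) b = false) (htw : ∀ c' : Fin 8, twinFailQ F.g F.w (SQ S) b c' = true) :
    IsEndMove (Xof S) WordVersion.v1 F.Φ (F.Φ (slotSite i)) (PQ q) (PQ b) := by
  subst hbq
  exact Or.inl ⟨Or.inr (Or.inr ⟨nv (F.w c), F.twinReading_of c hq, by rw [F.hinner, hperp]; simp⟩),
    (PQ_add_slot F q i).symm, F.not_isMoving _ hb htw⟩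

/-- CROSS end move: the predecessor `q` is twin-reading across `nv (w c)`, the direction `±gᵢ` crosses it upward
(`σ (sᵢ·c) = 2` with `d = σ gᵢ`), the end ball is `b = q − (mirrored direction)` and is not moving in the REFLECTED frame. -/
theorem RatFrame.isEndMove_cross (F : RatFrame) {S : Finset (Fin 3 → ℤ)} (q b : Fin 3 → ℚ) (i : Fin 12) (c : Fin 8)
    (σ : ℤ) (hup : σ * dz (slotInt i) (cubeInt c) = 2)
    (hbq : b = q - (σ : ℚ) • mirQ F.g F.w i c)
    (hq : twinOKQ F.g F.w (SQ S) q c = true)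
    (hb : fullQ (F.reflect c).g (SQ S) b = false) (htw : ∀ c' : Fin 8, twinFailQ (F.reflect c).g (F.reflect c).w (SQ S) b c' = true) :
    IsEndMove (Xof S) WordVersion.v1 F.Φ ((σ : ℝ) • F.Φ (slotSite i)) (PQ q) (PQ b) := by
  have h6 := sqrt6_pos
  have h6' : Real.sqrt 6 ≠ 0 := ne_of_gt h6
  have h23 : Real.sqrt (2 / 3) = 2 / Real.sqrt 6 := by
    rw [show (2 : ℝ) / 3 = 4 / 6 by norm_num, Real.sqrt_div (by norm_num), show (4 : ℝ) = 2 ^ 2 by norm_num,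
      Real.sqrt_sq (by norm_num)]
  -- the inner product of the direction with the crossing normal
  have hdm : ⟪(σ : ℝ) • F.Φ (slotSite i), nv (F.w c)⟫_ℝ = Real.sqrt (2 / 3) := by
    rw [real_inner_smul_left, F.hinner, h23]
    have : ((σ : ℝ) * (dz (slotInt i) (cubeInt c) : ℝ)) = 2 := by exact_mod_cast hup
    field_simp
    linarith [this]
  -- the mirrored direction
  have hmirdir : (σ : ℝ) • F.Φ (slotSite i) - (2 * ⟪(σ : ℝ) • F.Φ (slotSite i), nv (F.w c)⟫_ℝ) • nv (F.w c) =
      (σ : ℝ) • Qr (iptQ (mirQ F.g F.w i c)) := by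
    rw [← F.mirror_eq, real_inner_smul_left, smul_sub, smul_smul]
    congr 1
    congr 1
    ring
  refine Or.inr ⟨nv (F.w c), F.twinReading_of c hq, hdm, ?_, ?_⟩
  · -- `b = q − (d − 2⟪d, m⟫ m)`
    rw [hmirdir, hbq, PQ, PQ, iptQ_sub, map_sub, iptQ_smul, map_smul]
    push_cast; rfl
  · -- not moving in the reflected frame `F.Φ.trans (reflection across m)`
    have hframe : F.Φ.trans (ℝ ∙ nv (F.w c))ᗮ.reflection = (F.reflect c).Φ := rfl
    rw [hframe]
    exact (F.reflect c).not_isMoving _ hb htw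


/-! ### §11 Depth-one classes: the model letter of a cube vector, admissibility, assembled end pairs -/

/-- The MODEL letter attached to the sign vector `cubeInt c₀`: `μ = L⁻¹ (menuOf (cubeInt c₀))`. -/
def letter (c₀ : Fin 8) : EuclideanSpace ℝ (Fin 3) := L.symm (menuOf (cubeInt c₀))

/-- The letter is a unit vector. -/
theorem norm_letter (c₀ : Fin 8) : ‖letter c₀‖ = 1 := by
  rw [letter, L.symm.norm_map]; exact (isMenuNormal_menuOf c₀).1

/-- Model slot products with the letter. -/
theorem inner_slotSite_letter (i : Fin 12) (c₀ : Fin 8) :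
    ⟪slotSite i, letter c₀⟫_ℝ = (dz (slotInt i) (cubeInt c₀) : ℝ) / Real.sqrt 6 := by
  rw [letter, ← inner_L_slotSite_menuOf i (cubeInt c₀)]
  conv_rhs => rw [← L.apply_symm_apply (menuOf (cubeInt c₀))]
  rw [L.inner_map_map]

/-- The letter is a model menu normal. -/
theorem letter_menu (c₀ : Fin 8) : ∀ w ∈ fccSlots, ⟪w, letter c₀⟫_ℝ = 0 ∨ ⟪w, letter c₀⟫_ℝ = Real.sqrt (2 / 3) ∨
    ⟪w, letter c₀⟫_ℝ = -Real.sqrt (2 / 3) := by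
  intro w hw
  have h := (isMenuNormal_menuOf c₀).2 w hw
  have e : ⟪w, letter c₀⟫_ℝ = ⟪L w, menuOf (cubeInt c₀)⟫_ℝ := by
    rw [letter]
    conv_rhs => rw [← L.apply_symm_apply (menuOf (cubeInt c₀))]
    rw [L.inner_map_map]
  rw [e]; exact h

/-- **The depth-one chain frame is the reflected base frame**: `(M_μ).trans L = L.trans (reflection across menuOf)`. -/
theorem refl_letter_trans_L (c₀ : Fin 8) :
    ((ℝ ∙ letter c₀)ᗮ.reflection).trans L = (RatFrame.base.reflect c₀).Φ := by
  have hΦ : (RatFrame.base.reflect c₀).Φ = L.trans (Rf (wBase c₀)) := rfl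
  have hn : nv (wBase c₀) = menuOf (cubeInt c₀) := (menuOf_eq_nv (cubeInt c₀)).symm
  have hw3 : dq (wBase c₀) (wBase c₀) = 3 := RatFrame.base.hw c₀
  have hRf : ∀ y, Rf (wBase c₀) y = y - (2 * ⟪y, menuOf (cubeInt c₀)⟫_ℝ) • menuOf (cubeInt c₀) := by
    intro y
    rw [Rf, reflection_unit_apply (norm_nv hw3), hn]
  rw [hΦ]
  apply LinearIsometryEquiv.ext
  intro x
  rw [LinearIsometryEquiv.trans_apply, LinearIsometryEquiv.trans_apply, reflection_unit_apply (norm_letter c₀), hRf,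
    map_sub, map_smul, letter, L.apply_symm_apply]
  congr 2
  conv_rhs => rw [← L.apply_symm_apply (menuOf (cubeInt c₀))]
  rw [L.inner_map_map]

/-- **Admissibility of the depth-one class** of a root `sᵢ` rising across the letter `cubeInt c₀` (`sᵢ·c₀ = 2`): frame the
reflected base frame, direction `−Φ(sᵢ)`. -/
theorem adm_depth1 (T : PlateSystem) (hT : T.G₀ = L) {i : Fin 12} (hr : slotSite i ∈ T.RT) (c₀ : Fin 8)
    (hup : dz (slotInt i) (cubeInt c₀) = 2) :
    T.Adm (RatFrame.base.reflect c₀).Φ ((-1 : ℝ) • (RatFrame.base.reflect c₀).Φ (slotSite i)) := by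
  have hFw : T.Fw [letter c₀] = (RatFrame.base.reflect c₀).Φ := by
    rw [← refl_letter_trans_L]; simp only [PlateSystem.Fw, hT]
  refine ⟨slotSite i, hr, [letter c₀], ?_, hFw.symm, ?_⟩
  · simp only [WFChain, List.length_nil, pow_zero, one_smul, true_and]
    refine ⟨norm_letter c₀, letter_menu c₀, ?_, fun μ' κ' h => (List.cons_ne_nil μ' κ' h.symm).elim⟩
    rw [inner_slotSite_letter, hup]
    have h6 : (0 : ℝ) < Real.sqrt 6 := Real.sqrt_pos.2 (by norm_num)
    rw [show (2 : ℝ) / 3 = 4 / 6 by norm_num, Real.sqrt_div (by norm_num), show (4 : ℝ) = 2 ^ 2 by norm_num,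
      Real.sqrt_sq (by norm_num)]
    push_cast; ring
  · rw [hFw, List.length_singleton, pow_one, map_smul]

/-- Assembling an end pair of integer balls from an admissible class and an end move stated with rational points. -/
theorem isEndPair_gen {S : Finset (Fin 3 → ℤ)} {b q : Fin 3 → ℤ} (hq : q ∈ S) (hb : b ∈ S) (hdeg : degS S b ≤ 11)
    (G : EuclideanSpace ℝ (Fin 3) ≃ₗᵢ[ℝ] EuclideanSpace ℝ (Fin 3)) (d : EuclideanSpace ℝ (Fin 3))
    (hadm : S1.Adm G d ∨ S2.Adm G d) (hmove : IsEndMove (Xof S) WordVersion.v1 G d (PQ (castQ q)) (PQ (castQ b))) :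
    IsEndPair (Xof S) WordVersion.v1 S1 S2 (P b) (P q) := by
  refine ⟨mem_Xof.2 hq, mem_Xof.2 hb, hasTwoPayers_of_deg hdeg, G, d, hadm, ?_⟩
  rw [P_eq_PQ, P_eq_PQ]; exact hmove

/-- Root admissibility of `L (sᵢ)` in `S1` or `S2` from a non-zero rise number. -/
theorem adm_root_or {i : Fin 12} (hk : (slotKIJ i).1 = 0) (hN : (-24 * slotInt i 0 - 7 * slotInt i 2 : ℤ) ≠ 0) :
    S1.Adm L (L (slotSite i)) ∨ S2.Adm L (L (slotSite i)) :=
  (root_of_ne hk hN).imp (adm_of_root S1 rfl) (adm_of_root S2 rfl)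

/-- Depth-one admissibility in `S1` or `S2` from a non-zero rise number. -/
theorem adm_depth1_or {i : Fin 12} (hk : (slotKIJ i).1 = 0) (hN : (-24 * slotInt i 0 - 7 * slotInt i 2 : ℤ) ≠ 0)
    (c₀ : Fin 8) (hup : dz (slotInt i) (cubeInt c₀) = 2) :
    S1.Adm (RatFrame.base.reflect c₀).Φ ((-1 : ℝ) • (RatFrame.base.reflect c₀).Φ (slotSite i)) ∨
      S2.Adm (RatFrame.base.reflect c₀).Φ ((-1 : ℝ) • (RatFrame.base.reflect c₀).Φ (slotSite i)) :=
  (root_of_ne hk hN).imp (fun h => adm_depth1 S1 rfl h c₀ hup) (fun h => adm_depth1 S2 rfl h c₀ hup)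

/-- `L (sᵢ) = base.Φ (sᵢ)` (definitional) and the `σ = 1` form of the cross move. -/
theorem RatFrame.isEndMove_cross_one {S : Finset (Fin 3 → ℤ)} (q b : Fin 3 → ℚ) (i : Fin 12) (c : Fin 8)
    (hup : dz (slotInt i) (cubeInt c) = 2) (hbq : b = q - mirQ gBase wBase i c)
    (hq : twinOKQ gBase wBase (SQ S) q c = true)
    (hb : fullQ (RatFrame.base.reflect c).g (SQ S) b = false)
    (htw : ∀ c' : Fin 8, twinFailQ (RatFrame.base.reflect c).g (RatFrame.base.reflect c).w (SQ S) b c' = true) :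
    IsEndMove (Xof S) WordVersion.v1 L (L (slotSite i)) (PQ q) (PQ b) := by
  have h := RatFrame.base.isEndMove_cross (S := S) q b i c 1 (by rw [one_mul, hup]) (by rw [hbq]; push_cast; simp; rfl)
    hq hb htw
  have e1 : RatFrame.base.Φ = L := rfl
  rw [e1, Int.cast_one, one_smul] at h
  exact h

end EndRowFloor

end Summit.Ventures.Crystal3D.Theorems

end
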